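import Summits.HodgeConjecture.HodgeConjecture.Theses.SplitImpliesAll
import Summits.HodgeConjecture.HodgeConjecture.Theorems.SplitImpliesAllNonsplitCellsConnectedOfJ1
import Literature.AlgebraicGeometry.HodgeTheory.InvariantClassesFromTotalSpaceHolds
import HarnessLib

/-!
# `SplitImpliesAll.NonsplitCellsConnected` (K3) ⟸ the reach packages of the non-split right-sign sixfold cells

SUPPORT file for item stmt-HodgeConjecture-19825 (`NonsplitCellsConnected`, crux rank 4 of route `SplitImpliesAll`,
labelled IN PRINT). The item is NOT closed here. The landed `nonsplitCellsConnected_of_J1`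
(`Theorems/SplitImpliesAllNonsplitCellsConnectedOfJ1`) derives K3 from the named fact J1
`deligne1982_weilFamily_periodConstructionAtWeilType` — Deligne's level-`n'` family through EVERY Weil-type point, every
`n`, every `d`. This file records the MINIMAL TYPED RESIDUAL in the vocabulary of that file: K3 already follows from the
per-cell reach packages `CellSystemReachAt 3 d δ (CellFibre 3 d δ)` of the NON-SPLIT RIGHT-SIGN SIXFOLD CELLS ONLY
(`d ≥ 1`, `δ ≠ [(-1)³]`, `sign δ = (-1)³`), the second input of the M1ᶜ step
`isogenyConnectedToCMAnchor_of_cellSystemReachAt` being the TREE THEOREM `deligne1968_invariantClass_fromTotalSpace_holds`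
(Deligne 1968 / Voisin II Thm. 4.18, proved in `Literature/AlgebraicGeometry/HodgeTheory/InvariantClassesFromTotalSpaceHolds`).
The packages are the `(3, d)`-slices of J1 (`cellSystemReachAt_of_J1`), so `nonsplitCellsConnected_of_J1` factors through
this theorem (`nonsplitCellsConnected_of_cellSystemReachAt fun d hd δ _ _ => cellSystemReachAt_of_J1 hJ (by norm_num) hd δ`).
The fact-free part of K3 (members isogenous to the CM tower: the constant family) is
`Theorems/SplitImpliesAllIsogenyConnectedToCMAnchorConstantFamily`.

HONEST STATUS: nothing here is a case of the Hodge conjecture; HC / HC_CM / HC_AV are NOT proved; the packages are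
HYPOTHESES; the item stays OPEN — its unconditional closure needs the algebraic family of Deligne's proof of Thm. 4.8,
which the tree does not construct (no moduli space of abelian varieties, no universal abelian scheme, no period map).
-/

noncomputable section
set_option linter.dupNamespace false

open Literature.AlgebraicGeometry.HodgeTheory
open Literature.AlgebraicGeometry.VanGeemen1994
open Summit.HodgeConjecture.HodgeConjecture.Ring2.Hypotheses
open Summit.HodgeConjecture.HodgeConjecture.Ring2.AbelianAll
open Summit.HodgeConjecture.HodgeConjecture.Theorems.SplitImpliesAllNonsplitCellsConnectedOfJ1

namespace Summit.HodgeConjecture.HodgeConjecture.Theorems.SplitImpliesAllNonsplitCellsConnectedResidual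

/-- **K3 ⟸ the reach packages of the non-split right-sign sixfold cells.** Item stmt-HodgeConjecture-19825
`SplitImpliesAll.NonsplitCellsConnected` follows from `CellSystemReachAt 3 d δ (CellFibre 3 d δ)` for `d ≥ 1`,
`δ ≠ [(-1)³]`, `sign δ = (-1)³` — Deligne's family through each polarized Weil-type member of THOSE cells, with abelian
fibre charts in the cell, flat `(3,3)` Weil-valued sections and reach of every member of the cell up to `K`-isogeny —
and nothing else: the global-class input L of the M1ᶜ step is the tree theorem
`deligne1968_invariantClass_fromTotalSpace_holds`. SUPPORT theorem (the packages are hypotheses; in print: Deligne 1982 §4,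
proof of Thm. 4.8; van Geemen 5.3–5.5). [cite: Deligne1982HodgeCycles, §4, proof of Thm. 4.8 (a)–(c)]
[cite: vanGeemen1994HodgeAV, Lemma 5.2, 5.3–5.5 and 5.8–5.11] [cite: Deligne1968, Prop. (2.1) with (2.6.3)] -/
theorem nonsplitCellsConnected_of_cellSystemReachAt
    (hF : ∀ d : ℕ, 0 < d → ∀ δ : weilNormResidueGroup d, δ ≠ splitDiscriminantClass 3 d →
      weilSign d δ = (-1) ^ 3 → CellSystemReachAt 3 d δ (CellFibre 3 d δ)) :
    Summit.HodgeConjecture.HodgeConjecture.Theses.SplitImpliesAll.NonsplitCellsConnected :=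
  fun d hd δ hδ hs =>
    isogenyConnectedToCMAnchor_of_cellSystemReachAt (by norm_num) hd (hF d hd δ hδ hs)
      deligne1968_invariantClass_fromTotalSpace_holds

/-! ## §2 Exactness of the binders: the sign hypothesis of K3 is idle -/

/-- **K3 ⟺ N73 on EVERY non-split sixfold cell, whatever its sign** (fact-free). The binder `sign δ = (-1)³` of item
stmt-HodgeConjecture-19825 is idle: on a wrong-sign cell (`sign δ ≠ (-1)³`) the anchor-pointed leaf
`IsogenyConnectedToCMAnchor 3 d δ` holds VACUOUSLY (`Ring2.AbelianAll.isogenyConnectedToCMAnchor_of_weilSign_ne`: no polarized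
member of Weil type `(3,3)` has a `K`-Hermitian form of that sign, van Geemen Lemma 5.2 (4)), so K3 is literally «N73 on all
sixfold cells `δ ≠ [(-1)³]`». The remaining binder `δ ≠ [(-1)³]` is NOT idle (the split cell's N73 is a separate statement, in
print by the same construction). [cite: vanGeemen1994HodgeAV, Lemma 5.2 (4), 4.11 and 4.14] -/
theorem nonsplitCellsConnected_iff_forall_ne_split :
    Summit.HodgeConjecture.HodgeConjecture.Theses.SplitImpliesAll.NonsplitCellsConnected ↔
      ∀ d : ℕ, 0 < d → ∀ δ : weilNormResidueGroup d, δ ≠ splitDiscriminantClass 3 d →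
        IsogenyConnectedToCMAnchor 3 d δ := by
  constructor
  · intro h d hd δ hδ
    by_cases hs : weilSign d δ = (-1) ^ 3
    · exact h d hd δ hδ hs
    · exact isogenyConnectedToCMAnchor_of_weilSign_ne (by norm_num) hd hs
  · intro h d hd δ hδ _
    exact h d hd δ hδ

/-- **K3 ⟸ N73 on all sixfold cells** — the shape in which the J1 road delivers it (`isogenyConnectedToCMAnchor_of_J1` proves
`IsogenyConnectedToCMAnchor n d δ` for every `n, d ≥ 1` and EVERY `δ`, split cell included). [cite: Deligne1982HodgeCycles, §4, proof of Thm. 4.8] -/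
theorem nonsplitCellsConnected_of_forall_cells
    (h : ∀ d : ℕ, 0 < d → ∀ δ : weilNormResidueGroup d, IsogenyConnectedToCMAnchor 3 d δ) :
    Summit.HodgeConjecture.HodgeConjecture.Theses.SplitImpliesAll.NonsplitCellsConnected :=
  nonsplitCellsConnected_iff_forall_ne_split.2 fun d hd δ _ => h d hd δ

end Summit.HodgeConjecture.HodgeConjecture.Theorems.SplitImpliesAllNonsplitCellsConnectedResidual

end
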